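import Summits.RiemannHypothesis.RiemannHypothesis.Theorems.HandoffDodgerSmallCost
import HarnessLib

/-!
# HANDOFF — SIXTH SLAB (4): the cost/gain comparison at `y = 16`, `α = 47/100`, generic `κ₀`, SHARP far tail, on `640 ≤ q < 1015` (rh-explicit, W-P(P2) crux 19172 residue, seat prove-2 gen14; ATTEMPT-24 §3)

RH-FREE. HONEST FRAMING: nothing here bears on the truth of RH; part (4) of the discharge of the hypotheses of
`HandoffDodgerExplicitWindowCountingFT.dodger_witness_explicit_window_counting_ft` on the sixth slab `640 ≤ q < 1015` (`3.22 ≤ b ≤ 3.47`,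
`10700 ≤ T′`, `T′³/60 ≤ cI ≤ T′³/56.548`, `k′ ≤ 0.3184·b·T′`, `pU ≤ 1.106·T′³`), with CRUDE but provable constants:
* cost prefactor `≤ 21.2·e^b`; first cost term `≤ 1/(T√T)`; second (the SHARP far tail of ATTEMPT-24 brick FT,
  `e^{144(2k)²/(7c_L)}·(0.1615·log x_L − 0.11)/x_L`) `≤ 4.44(b+0.607)/(T√T)` — this is where brick FT pays: dodger-p2's fifth slab had
  `6010(b+1.17)/(T√T)` here; total `≤ 2.74(b+0.834)e^{−2b}`;
* WINDOW gain (`α = 47/100`): `≥ 0.0256·κ₀²·Φ₀²/(b·e^{4b})` for any `0 ≤ κ₀ ≤ κ`, `0 ≤ Φ₀ ≤ Φ` (at `y = 16`, `600r ≤ δL`, `Q ≤ 1.0001e^b`);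
* hence `cost < gain` as soon as `2.74·B₂(B₂+0.834)·X < 0.0256·κ₀²·Φ₀²` for any `b ≤ B₂`, `e^{2b} ≤ X` — the numeric form consumed
  PER SUB-SLAB by the assembly `HandoffDodgerSlabSixCeiling` (part (5): `Φ₀ ≥ 7960`). dodger-p2's `HandoffDodgerSlabFiveCost` re-constanted.

References: this track (ATTEMPT-16 §4–§6, ATTEMPT-19 §7, ATTEMPT-21 §5, ATTEMPT-23 §2/§7, ATTEMPT-24 §1–§3; HOME/rh-explicit-dodger-p2/DODGER-STAGE2-PLAN.md §2).
-/

set_option linter.dupNamespace false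

noncomputable section

open Real

namespace Summit.RiemannHypothesis.RiemannHypothesis.Theorems.Handoff

/-- **The cost prefactor on the sixth slab.** `0 ≤ δ ≤ 1/1250`, `b ≥ 3.22`, `e^{2b} ≥ 639` ⟹
`4(sinh²(δ/2)+1)·e·(4cosh²(b/2)(1+b)²/b²) ≤ 21.2·e^b`. [this track, ATTEMPT-23 §7; ATTEMPT-24 §3] -/
theorem cost_prefactor_le_slabSix {δ b : ℝ} (hδ0 : 0 ≤ δ) (hδ1 : δ ≤ 1 / 1250) (hb0 : 161 / 50 ≤ b)
    (he : 639 ≤ Real.exp (2 * b)) :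
    4 * (Real.sinh (δ / 2) ^ 2 + 1) * Real.exp 1 * (4 * Real.cosh (b / 2) ^ 2 * (1 + b) ^ 2 / b ^ 2) ≤
      21.2 * Real.exp b := by
  have hb00 : 0 < b := by linarith
  have cosh_le : ∀ x : ℝ, 0 ≤ x → Real.cosh x ≤ Real.exp x := fun x hx => by
    rw [Real.cosh_eq]
    have : Real.exp (-x) ≤ Real.exp x := Real.exp_le_exp.2 (by linarith)
    linarith
  have h1 : Real.sinh (δ / 2) ^ 2 + 1 ≤ 1.002 := by
    rw [← Real.cosh_sq]
    have hc := cosh_le (δ / 2) (by linarith)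
    have hc0 : 0 ≤ Real.cosh (δ / 2) := (Real.cosh_pos _).le
    have hexpδ : Real.exp δ ≤ 1 + 2 * δ := by
      have := Real.abs_exp_sub_one_le (x := δ) (by rw [abs_of_nonneg hδ0]; linarith)
      rw [abs_of_nonneg hδ0] at this
      have := (abs_le.1 this).2
      linarith
    calc Real.cosh (δ / 2) ^ 2 ≤ Real.exp (δ / 2) ^ 2 := pow_le_pow_left₀ hc0 hc 2
      _ = Real.exp δ := by rw [← Real.exp_nat_mul]; ring_nf
      _ ≤ 1.002 := by linarith
  set Eb := Real.exp b with hEb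
  have hEb0 : 0 < Eb := Real.exp_pos b
  have hE2 : Real.exp (2 * b) = Eb ^ 2 := by rw [hEb, ← Real.exp_nat_mul]; ring_nf
  have hEb173 : 25.2 ≤ Eb := by
    rw [hE2] at he; nlinarith only [he, hEb0]
  have h2 : 4 * Real.cosh (b / 2) ^ 2 ≤ 1.12 * Eb := by
    have hhalf : Real.exp (b / 2) ^ 2 = Eb := by rw [hEb, ← Real.exp_nat_mul]; ring_nf
    have hneg : Real.exp (-(b / 2)) * Real.exp (b / 2) = 1 := by rw [← Real.exp_add]; norm_num
    have e4 : 4 * Real.cosh (b / 2) ^ 2 = Eb + 2 + Real.exp (-(b / 2)) ^ 2 := by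
      rw [Real.cosh_eq]; nlinarith only [hhalf, hneg]
    have hinv : Real.exp (-(b / 2)) ^ 2 ≤ 1 := by
      have : Real.exp (-(b / 2)) ≤ 1 := by rw [Real.exp_le_one_iff]; linarith
      have h0 := (Real.exp_pos (-(b / 2))).le
      nlinarith only [this, h0]
    rw [e4]; nlinarith only [hinv, hEb173]
  have h3 : (1 + b) ^ 2 / b ^ 2 ≤ 1.73 := by
    rw [div_le_iff₀ (by positivity)]; nlinarith only [hb0, sq_nonneg (b - 161 / 50)]
  have hel := Real.exp_one_lt_d9
  have h4 : 4 * Real.cosh (b / 2) ^ 2 * (1 + b) ^ 2 / b ^ 2 ≤ 1.12 * Eb * 1.73 := by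
    rw [mul_div_assoc]
    exact mul_le_mul h2 h3 (by positivity) (by positivity)
  calc 4 * (Real.sinh (δ / 2) ^ 2 + 1) * Real.exp 1 * (4 * Real.cosh (b / 2) ^ 2 * (1 + b) ^ 2 / b ^ 2)
      ≤ 4 * 1.002 * 2.7182818286 * (1.12 * Eb * 1.73) := by
        have a : 4 * (Real.sinh (δ / 2) ^ 2 + 1) * Real.exp 1 ≤ 4 * 1.002 * 2.7182818286 := by
          have := Real.exp_pos 1
          nlinarith only [h1, hel, this, Real.cosh_sq (δ / 2), sq_nonneg (Real.sinh (δ / 2))]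
        exact mul_le_mul a h4 (by positivity) (by positivity)
    _ ≤ 21.2 * Eb := by nlinarith only [hEb0]

set_option maxHeartbeats 400000 in
/-- **The first cost term on the sixth slab** `≤ 1/(T√T)`. [this track, ATTEMPT-23 §7] -/
theorem cost_first_le_slabSix {T b k cI cL : ℝ} (hb0 : 161 / 50 ≤ b) (hb1 : b ≤ 347 / 100) (hT : 10700 ≤ T)
    (hTT₀ : T ≤ 2 * π * Real.exp (1 + 2 * b)) (hk2 : 2 ≤ k) (hk : k ≤ 0.3184 * b * T)
    (hcI : T ^ 3 / 60 ≤ cI) (hcL : cL = 4 * cI) :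
    ((2 * T) / (2 * π) * Real.log ((2 * T) / (2 * π * Real.exp 1)) +
          (0.1038 * Real.log (2 * T) + 0.2573 * Real.log (Real.log (2 * T)) + 9.3675)) / T ^ 2 *
        Real.exp (4 * (b / π * (1 + Real.log (k - 1))) - cL / (2 * T + 1) ^ 2) ≤ 1 / (T * Real.sqrt T) := by
  have hπ3 : 3 < π := Real.pi_gt_three
  have hb00 : 0 < b := by linarith
  have hT0 : 0 < T := by linarith
  have hN := count_factor_le_one (by linarith : 100 ≤ T)
  refine (mul_le_of_le_one_left (Real.exp_pos _).le hN).trans ?_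
  have hlogk : Real.log (k - 1) ≤ 3 * b + 2 := by
    have h1 : Real.log (k - 1) ≤ Real.log k := Real.log_le_log (by linarith) (by linarith)
    have h2 : Real.log k ≤ Real.log (b * T) := Real.log_le_log (by linarith) (by nlinarith)
    rw [Real.log_mul hb00.ne' hT0.ne'] at h2
    have h3 : Real.log b ≤ b - 1 := Real.log_le_sub_one_of_pos hb00
    have h4 := log_horizon_le_small hT0 hTT₀
    linarith
  have hA : 4 * (b / π * (1 + Real.log (k - 1))) ≤ 6 * b ^ 2 := by
    have h1 : b / π ≤ b / 3 := div_le_div_of_nonneg_left hb00.le (by norm_num) hπ3.le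
    have h2 : 0 ≤ 1 + Real.log (k - 1) := by
      have : 0 ≤ Real.log (k - 1) := Real.log_nonneg (by linarith)
      linarith
    have h3 : b / π * (1 + Real.log (k - 1)) ≤ b / 3 * (3 * b + 3) :=
      mul_le_mul h1 (by linarith) h2 (by positivity)
    nlinarith
  have hB : T / 60.6 ≤ cL / (2 * T + 1) ^ 2 := by
    rw [hcL, div_le_div_iff₀ (by norm_num) (by positivity)]
    have h1 : (2 * T + 1) ^ 2 ≤ 4.04 * T ^ 2 := by nlinarith
    have h3 : T * (2 * T + 1) ^ 2 ≤ T * (4.04 * T ^ 2) := mul_le_mul_of_nonneg_left h1 hT0.le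
    have h4 : T ^ 3 ≤ 60 * cI := by rw [div_le_iff₀ (by norm_num)] at hcI; linarith
    nlinarith
  have hE : 4 * (b / π * (1 + Real.log (k - 1))) - cL / (2 * T + 1) ^ 2 ≤ -(T / 120) := by
    have : 6 * b ^ 2 ≤ T / 60.6 - T / 120 := by
      rw [div_sub_div _ _ (by norm_num) (by norm_num), le_div_iff₀ (by norm_num)]; nlinarith
    linarith
  refine (Real.exp_le_exp.2 hE).trans ?_
  rw [Real.exp_neg, one_div, inv_le_inv₀ (Real.exp_pos _) (by positivity)]
  have h3 : (T / 120) ^ 4 / 24 ≤ Real.exp (T / 120) := by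
    have := Real.pow_div_factorial_le_exp (T / 120) (by positivity) 4
    norm_num [Nat.factorial] at this; exact this
  have hs : Real.sqrt T ≤ T / 103 := by
    rw [Real.sqrt_le_left (by positivity)]; nlinarith
  have h4 : T * Real.sqrt T ≤ T * (T / 103) := mul_le_mul_of_nonneg_left hs hT0.le
  have hT2 : (10700 : ℝ) ^ 2 ≤ T ^ 2 := pow_le_pow_left₀ (by norm_num) hT 2
  have h5 : T * (T / 103) ≤ (T / 120) ^ 4 / 24 := by nlinarith [hT2, sq_nonneg T]
  linarith

set_option maxHeartbeats 400000 in
/-- **The second cost term on the sixth slab (SHARP far tail)** `≤ 4.44(b+0.607)/(T√T)` (with `cI ≤ T³/56.548`: `log xL ≤ 3b + 2.5`;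
`xL ≥ T√T/7.75`). [this track, ATTEMPT-23 §7; ATTEMPT-24 §1–§3] -/
theorem cost_second_le_slabSix {T b k cI cL xL : ℝ} (hb0 : 161 / 50 ≤ b) (hb1 : b ≤ 347 / 100) (hT : 10700 ≤ T)
    (hTT₀ : T ≤ 2 * π * Real.exp (1 + 2 * b)) (hk2 : 2 ≤ k) (hk : k ≤ 0.3184 * b * T)
    (hcI : T ^ 3 / 60 ≤ cI) (hcI3 : cI ≤ T ^ 3 / 56.548) (hcL : cL = 4 * cI) (hxL : xL = Real.sqrt (cL / 4)) :
    Real.exp (144 * (2 * k) ^ 2 / (7 * cL)) * ((0.1615 * Real.log xL - 0.11) / xL) ≤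
      4.44 * (b + 0.607) / (T * Real.sqrt T) := by
  have hb00 : 0 < b := by linarith
  have hT0 : 0 < T := by linarith
  have hx : xL = Real.sqrt cI := by rw [hxL, hcL]; ring_nf
  have hcIpos : 0 < cI := lt_of_lt_of_le (by positivity) hcI
  have hTs : 0 < T * Real.sqrt T := by positivity
  have hx1 : T * Real.sqrt T / 7.75 ≤ xL := by
    rw [hx, Real.le_sqrt (by positivity) hcIpos.le, div_pow, mul_pow, Real.sq_sqrt hT0.le]
    rw [div_le_iff₀ (by norm_num)]; rw [div_le_iff₀ (by norm_num)] at hcI; nlinarith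
  have hx2 : 100 ≤ xL := by
    have : 775 ≤ T * Real.sqrt T := by
      have hs : 1 ≤ Real.sqrt T := by rw [Real.le_sqrt (by norm_num) hT0.le]; nlinarith
      nlinarith
    have : 100 ≤ T * Real.sqrt T / 7.75 := by rw [le_div_iff₀ (by norm_num)]; linarith
    linarith
  have hx0 : 0 < xL := by linarith
  have hlx1 : 1 ≤ Real.log xL := by
    rw [Real.le_log_iff_exp_le hx0]; have := Real.exp_one_lt_d9; linarith
  -- `log xL = ½ log cI ≤ ½ (3 log T − log 56.548) ≤ 1.5(2b+3) − 2`
  have hlx : Real.log xL ≤ 3 * b + 2.5 := by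
    rw [hx, Real.log_sqrt hcIpos.le]
    have hq0 : 0 < T ^ 3 / 56.548 := by positivity
    have h1 : Real.log cI ≤ Real.log (T ^ 3 / 56.548) := Real.log_le_log hcIpos hcI3
    rw [Real.log_div (by positivity) (by norm_num), Real.log_pow] at h1
    have h56 : (4 : ℝ) ≤ Real.log 56.548 := by
      rw [Real.le_log_iff_exp_le (by norm_num)]
      have := exp_numerics.2.2.1
      linarith
    have h2 := log_horizon_le_small hT0 hTT₀
    push_cast at h1
    linarith
  have hexp : Real.exp (144 * (2 * k) ^ 2 / (7 * cL)) ≤ 1.18 := by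
    have hu0 : 0 ≤ 144 * (2 * k) ^ 2 / (7 * cL) := by rw [hcL]; positivity
    have hu : 144 * (2 * k) ^ 2 / (7 * cL) ≤ 15 / 100 := by
      rw [hcL, div_le_div_iff₀ (by positivity) (by norm_num)]
      have hkT : k ≤ 1.105 * T := by nlinarith only [hk, hb1, hT0]
      have h1 : (2 * k) ^ 2 ≤ (2 * (1.105 * T)) ^ 2 := pow_le_pow_left₀ (by linarith) (by linarith) 2
      have h3 : T ^ 3 ≤ 60 * cI := by rw [div_le_iff₀ (by norm_num)] at hcI; linarith
      have h5 : 10700 * T ^ 2 ≤ T ^ 3 := by nlinarith [sq_nonneg T]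
      nlinarith [h1, h3, h5, sq_nonneg T]
    have := Real.abs_exp_sub_one_sub_id_le (x := 144 * (2 * k) ^ 2 / (7 * cL)) (by rw [abs_of_nonneg hu0]; linarith)
    have := (abs_le.1 this).2
    nlinarith
  have hbr : (0.1615 * Real.log xL - 0.11) / xL ≤ 0.4845 * (b + 0.607) / xL :=
    div_le_div_of_nonneg_right (by linarith) hx0.le
  have hbr0 : 0 ≤ (0.1615 * Real.log xL - 0.11) / xL := div_nonneg (by linarith) hx0.le
  calc Real.exp (144 * (2 * k) ^ 2 / (7 * cL)) * ((0.1615 * Real.log xL - 0.11) / xL)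
      ≤ 1.18 * (0.4845 * (b + 0.607) / xL) := mul_le_mul hexp hbr hbr0 (by norm_num)
    _ ≤ 1.18 * (0.4845 * (b + 0.607) / (T * Real.sqrt T / 7.75)) := by
        have := div_le_div_of_nonneg_left (by positivity : 0 ≤ 0.4845 * (b + 0.607)) (by positivity) hx1
        nlinarith
    _ = 1.18 * 0.4845 * 7.75 * (b + 0.607) / (T * Real.sqrt T) := by field_simp
    _ ≤ 4.44 * (b + 0.607) / (T * Real.sqrt T) := by
        apply div_le_div_of_nonneg_right _ hTs.le; nlinarith

set_option maxHeartbeats 400000 in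
/-- **Total cost on the sixth slab** `≤ 2.74(b+0.834)/e^{2b}`. [this track, ATTEMPT-23 §7; ATTEMPT-24 §3] -/
theorem cost_le_slabSix {T b k cI cL xL δU : ℝ} (hb0 : 161 / 50 ≤ b) (hb1 : b ≤ 347 / 100) (he : 639 ≤ Real.exp (2 * b))
    (hTe : 16.8 * Real.exp (2 * b) ≤ T) (hTT₀ : T ≤ 2 * π * Real.exp (1 + 2 * b))
    (hk2 : 2 ≤ k) (hk : k ≤ 0.3184 * b * T)
    (hcI : T ^ 3 / 60 ≤ cI) (hcI3 : cI ≤ T ^ 3 / 56.548) (hcL : cL = 4 * cI) (hxL : xL = Real.sqrt (cL / 4))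
    (hδ0 : 0 ≤ δU) (hδ1 : δU ≤ 1 / 1250) :
    2 * (4 * (Real.sinh (δU / 2) ^ 2 + 1) * Real.exp 1 * (4 * Real.cosh (b / 2) ^ 2 * (1 + b) ^ 2 / b ^ 2)) *
        (((2 * T) / (2 * π) * Real.log ((2 * T) / (2 * π * Real.exp 1)) +
              (0.1038 * Real.log (2 * T) + 0.2573 * Real.log (Real.log (2 * T)) + 9.3675)) / T ^ 2 *
            Real.exp (4 * (b / π * (1 + Real.log (k - 1))) - cL / (2 * T + 1) ^ 2) +
          Real.exp (144 * (2 * k) ^ 2 / (7 * cL)) * ((0.1615 * Real.log xL - 0.11) / xL)) ≤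
      2.74 * (b + 0.834) / Real.exp (2 * b) := by
  have hb00 : 0 < b := by linarith
  set Eb := Real.exp b with hEb
  have hEb0 : 0 < Eb := Real.exp_pos b
  have hE2 : Real.exp (2 * b) = Eb ^ 2 := by rw [hEb, ← Real.exp_nat_mul]; ring_nf
  have hT : 10700 ≤ T := by linarith only [he, hTe]
  have hT0 : 0 < T := by linarith
  have hP := cost_prefactor_le_slabSix hδ0 hδ1 hb0 he
  have hF := cost_first_le_slabSix hb0 hb1 hT hTT₀ hk2 hk hcI hcL
  have hS := cost_second_le_slabSix hb0 hb1 hT hTT₀ hk2 hk hcI hcI3 hcL hxL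
  have hTs : 0 < T * Real.sqrt T := by positivity
  have hT16 : 16.8 * Eb ^ 2 ≤ T := by rw [← hE2]; exact hTe
  have hsq : 4.098 * Eb ≤ Real.sqrt T := by
    rw [Real.le_sqrt (by positivity) hT0.le]; nlinarith only [hT16, pow_pos hEb0 2]
  have hTs2 : 68.8 * Eb * Eb ^ 2 ≤ T * Real.sqrt T := by
    have := mul_le_mul hT16 hsq (by positivity) hT0.le; nlinarith only [this, pow_pos hEb0 3]
  have hsum : ((2 * T) / (2 * π) * Real.log ((2 * T) / (2 * π * Real.exp 1)) +
              (0.1038 * Real.log (2 * T) + 0.2573 * Real.log (Real.log (2 * T)) + 9.3675)) / T ^ 2 *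
            Real.exp (4 * (b / π * (1 + Real.log (k - 1))) - cL / (2 * T + 1) ^ 2) +
          Real.exp (144 * (2 * k) ^ 2 / (7 * cL)) * ((0.1615 * Real.log xL - 0.11) / xL) ≤
        4.44 * (b + 0.834) / (68.8 * Eb * Eb ^ 2) := by
    have h1 : 1 / (T * Real.sqrt T) + 4.44 * (b + 0.607) / (T * Real.sqrt T) ≤ 4.44 * (b + 0.834) / (T * Real.sqrt T) := by
      rw [← add_div]; exact div_le_div_of_nonneg_right (by linarith) hTs.le
    have h2 : 4.44 * (b + 0.834) / (T * Real.sqrt T) ≤ 4.44 * (b + 0.834) / (68.8 * Eb * Eb ^ 2) :=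
      div_le_div_of_nonneg_left (by positivity) (by positivity) hTs2
    linarith
  have hsum0 : 0 ≤ 4.44 * (b + 0.834) / (68.8 * Eb * Eb ^ 2) := by positivity
  calc 2 * (4 * (Real.sinh (δU / 2) ^ 2 + 1) * Real.exp 1 * (4 * Real.cosh (b / 2) ^ 2 * (1 + b) ^ 2 / b ^ 2)) *
        (((2 * T) / (2 * π) * Real.log ((2 * T) / (2 * π * Real.exp 1)) +
              (0.1038 * Real.log (2 * T) + 0.2573 * Real.log (Real.log (2 * T)) + 9.3675)) / T ^ 2 *
            Real.exp (4 * (b / π * (1 + Real.log (k - 1))) - cL / (2 * T + 1) ^ 2) +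
          Real.exp (144 * (2 * k) ^ 2 / (7 * cL)) * ((0.1615 * Real.log xL - 0.11) / xL))
      ≤ 2 * (4 * (Real.sinh (δU / 2) ^ 2 + 1) * Real.exp 1 * (4 * Real.cosh (b / 2) ^ 2 * (1 + b) ^ 2 / b ^ 2)) *
        (4.44 * (b + 0.834) / (68.8 * Eb * Eb ^ 2)) := mul_le_mul_of_nonneg_left hsum (by positivity)
    _ ≤ 2 * (21.2 * Eb) * (4.44 * (b + 0.834) / (68.8 * Eb * Eb ^ 2)) :=
        mul_le_mul_of_nonneg_right (by linarith) hsum0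
    _ = 2 * 21.2 * 4.44 / 68.8 * (b + 0.834) / Eb ^ 2 := by field_simp
    _ ≤ 2.74 * (b + 0.834) / Real.exp (2 * b) := by
        rw [hE2]; apply div_le_div_of_nonneg_right _ (by positivity); nlinarith

/-- **Total WINDOW gain on the sixth slab** `≥ 0.0256·κ₀²·Φ₀²/(b·e^{4b})` for any `0 ≤ κ₀ ≤ κ`, `0 ≤ Φ₀ ≤ Φ`, at `y = 16`,
`α = 47/100`, `600r ≤ δL`, `Q ≤ 1.0001e^b`, `pU ≤ 1.106T³`, `T ≤ 2πe^{1+2b}`, `2b ≤ L`. [this track, ATTEMPT-23 §7; ATTEMPT-24 §3] -/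
theorem gain_ge_slabSix {b L Q δL r κ κ₀ y pU T Φ Φ₀ : ℝ} (hb0 : 161 / 50 ≤ b) (hL1 : 2 * b ≤ L)
    (hQ0 : 0 < Q) (hQ : Q ≤ 1.0001 * Real.exp b) (hκ₀ : 0 ≤ κ₀) (hκ : κ₀ ≤ κ) (hr : 600 * r ≤ δL)
    (hy : y = 16) (hδL : δL = y / Real.sqrt pU) (hpU0 : 0 < pU)
    (hpU : pU ≤ 1.106 * T ^ 3) (hT0 : 0 < T) (hTT₀ : T ≤ 2 * π * Real.exp (1 + 2 * b))
    (hΦ₀ : 0 ≤ Φ₀) (hΦ : Φ₀ ≤ Φ) :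
    256 / 10000 * κ₀ ^ 2 * Φ₀ ^ 2 / (b * Real.exp (4 * b)) ≤
      2 * L / Q * ((1 - 2 * (47 / 100 : ℝ)) * (2 * (δL - 3 * r)) * (κ ^ 2 / (4 * b ^ 2)) * Φ ^ 2) := by
  have hπ4 : π < 3.1416 := Real.pi_lt_d4
  have hb00 : 0 < b := by linarith
  have hL0 : 0 < L := by linarith
  set Eb := Real.exp b with hEb
  have hEb0 : 0 < Eb := Real.exp_pos b
  have hE2 : Real.exp (2 * b) = Eb ^ 2 := by rw [hEb, ← Real.exp_nat_mul]; ring_nf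
  have hE4 : Real.exp (4 * b) = Eb ^ 4 := by rw [hEb, ← Real.exp_nat_mul]; ring_nf
  have hT17 : T ≤ 17.08 * Eb ^ 2 := by
    have e1 : Real.exp (1 + 2 * b) = Real.exp 1 * Eb ^ 2 := by rw [Real.exp_add, hE2]
    rw [e1] at hTT₀
    have h2πe : 2 * π * Real.exp 1 ≤ 17.08 := by
      have hel := Real.exp_one_lt_d9
      nlinarith only [hπ4, hel, Real.exp_pos 1, Real.pi_pos]
    have := mul_le_mul_of_nonneg_right h2πe (pow_pos hEb0 2).le
    nlinarith only [this, hTT₀]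
  -- `δL ≥ D = 0.215/Eb³`
  have hy0 : 0 ≤ y := by rw [hy]; norm_num
  set D : ℝ := 0.215 / Eb ^ 3 with hD
  have hD0 : 0 ≤ D := by positivity
  have hDδ : D ≤ δL := by
    have e : δL = Real.sqrt (y ^ 2 / pU) := by rw [hδL, Real.sqrt_div (sq_nonneg y), Real.sqrt_sq hy0]
    rw [e, Real.le_sqrt hD0 (by positivity), hD, div_pow, div_le_div_iff₀ (by positivity) hpU0, hy]
    have hT3 : T ^ 3 ≤ (17.08 * Eb ^ 2) ^ 3 := pow_le_pow_left₀ hT0.le hT17 3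
    have h1 : (0.215 : ℝ) ^ 2 * pU ≤ 0.215 ^ 2 * (1.106 * (17.08 * Eb ^ 2) ^ 3) := by
      apply mul_le_mul_of_nonneg_left _ (by positivity); nlinarith only [hpU, hT3]
    have h3 : (0.215 : ℝ) ^ 2 * (1.106 * (17.08 * Eb ^ 2) ^ 3) ≤ 16 ^ 2 * (Eb ^ 3) ^ 2 := by
      have : 0 ≤ Eb ^ 6 := by positivity
      nlinarith only [this]
    linarith only [h1, h3]
  -- factor lower bounds
  have A1 : 4 * b / (1.0001 * Eb) ≤ 2 * L / Q := by
    rw [div_le_div_iff₀ (by positivity) hQ0]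
    have := mul_le_mul_of_nonneg_left hQ hb00.le
    nlinarith only [this, hL1, hEb0]
  have A2 : 199 / 100 * D ≤ 2 * (δL - 3 * r) := by linarith only [hDδ, hr, hD0]
  have hκ0 : 0 ≤ κ := hκ₀.trans hκ
  have A3 : κ₀ ^ 2 / (4 * b ^ 2) ≤ κ ^ 2 / (4 * b ^ 2) :=
    div_le_div_of_nonneg_right (pow_le_pow_left₀ hκ₀ hκ 2) (by positivity)
  have A4 : Φ₀ ^ 2 ≤ Φ ^ 2 := pow_le_pow_left₀ hΦ₀ hΦ 2
  have h25 : (1 - 2 * (47 / 100 : ℝ)) = 3 / 50 := by norm_num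
  rw [h25]
  have B1 : 3 / 50 * (199 / 100 * D) * (κ₀ ^ 2 / (4 * b ^ 2)) ≤ 3 / 50 * (2 * (δL - 3 * r)) * (κ ^ 2 / (4 * b ^ 2)) :=
    mul_le_mul (mul_le_mul_of_nonneg_left A2 (by norm_num)) A3 (by positivity) (by linarith only [A2, hD0])
  have B2 : 3 / 50 * (199 / 100 * D) * (κ₀ ^ 2 / (4 * b ^ 2)) * Φ₀ ^ 2 ≤
      3 / 50 * (2 * (δL - 3 * r)) * (κ ^ 2 / (4 * b ^ 2)) * Φ ^ 2 :=
    mul_le_mul B1 A4 (by positivity) (mul_nonneg (by linarith only [A2, hD0]) (by positivity))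
  have B3 : 4 * b / (1.0001 * Eb) * (3 / 50 * (199 / 100 * D) * (κ₀ ^ 2 / (4 * b ^ 2)) * Φ₀ ^ 2) ≤
      2 * L / Q * (3 / 50 * (2 * (δL - 3 * r)) * (κ ^ 2 / (4 * b ^ 2)) * Φ ^ 2) :=
    mul_le_mul A1 B2 (by positivity) (by positivity)
  refine le_trans ?_ B3
  rw [hD, hE4]
  rw [show 4 * b / (1.0001 * Eb) * (3 / 50 * (199 / 100 * (0.215 / Eb ^ 3)) * (κ₀ ^ 2 / (4 * b ^ 2)) * Φ₀ ^ 2)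
      = (4 * 3 * 199 * 0.215 / (1.0001 * 50 * 100 * 4)) * (κ₀ ^ 2 * Φ₀ ^ 2 / (b * Eb ^ 4)) by field_simp]
  rw [show 256 / 10000 * κ₀ ^ 2 * Φ₀ ^ 2 / (b * Eb ^ 4) = 256 / 10000 * (κ₀ ^ 2 * Φ₀ ^ 2 / (b * Eb ^ 4)) by ring]
  have h0 : 0 ≤ κ₀ ^ 2 * Φ₀ ^ 2 / (b * Eb ^ 4) := by positivity
  nlinarith only [h0]

set_option maxHeartbeats 400000 in
/-- **The comparison (abstract form of `hlt` of `dodger_witness_explicit_window_counting_ft`, `α = 47/100`) on the sixth slab**, given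
`b ≤ B₂`, `e^{2b} ≤ X` and the NUMERIC inequality `2.74·B₂(B₂+0.834)·X < 0.0256·κ₀²·Φ₀²` of the sub-slab.
[this track, ATTEMPT-23 §7; ATTEMPT-24 §3] -/
theorem cost_lt_gain_slabSix {T b k cI cL xL δU L Q δL r κ κ₀ y pU Φ Φ₀ B₂ X : ℝ} (hb0 : 161 / 50 ≤ b) (hb1 : b ≤ 347 / 100)
    (he : 639 ≤ Real.exp (2 * b)) (hL1 : 2 * b ≤ L)
    (hTe : 16.8 * Real.exp (2 * b) ≤ T) (hTT₀ : T ≤ 2 * π * Real.exp (1 + 2 * b))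
    (hk2 : 2 ≤ k) (hk : k ≤ 0.3184 * b * T)
    (hcI : T ^ 3 / 60 ≤ cI) (hcI3 : cI ≤ T ^ 3 / 56.548) (hcL : cL = 4 * cI) (hxL : xL = Real.sqrt (cL / 4))
    (hδ0 : 0 ≤ δU) (hδ1 : δU ≤ 1 / 1250)
    (hQ0 : 0 < Q) (hQ : Q ≤ 1.0001 * Real.exp b) (hκ₀ : 0 ≤ κ₀) (hκ : κ₀ ≤ κ) (hr : 600 * r ≤ δL)
    (hy : y = 16) (hδL : δL = y / Real.sqrt pU) (hpU0 : 0 < pU)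
    (hpU : pU ≤ 1.106 * T ^ 3) (hΦ₀ : 0 ≤ Φ₀) (hΦ : Φ₀ ≤ Φ)
    (hbB : b ≤ B₂) (hX : Real.exp (2 * b) ≤ X)
    (hval : 2.74 * B₂ * (B₂ + 0.834) * X < 256 / 10000 * κ₀ ^ 2 * Φ₀ ^ 2) :
    2 * (4 * (Real.sinh (δU / 2) ^ 2 + 1) * Real.exp 1 * (4 * Real.cosh (b / 2) ^ 2 * (1 + b) ^ 2 / b ^ 2)) *
        (((2 * T) / (2 * π) * Real.log ((2 * T) / (2 * π * Real.exp 1)) +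
              (0.1038 * Real.log (2 * T) + 0.2573 * Real.log (Real.log (2 * T)) + 9.3675)) / T ^ 2 *
            Real.exp (4 * (b / π * (1 + Real.log (k - 1))) - cL / (2 * T + 1) ^ 2) +
          Real.exp (144 * (2 * k) ^ 2 / (7 * cL)) * ((0.1615 * Real.log xL - 0.11) / xL)) <
      2 * L / Q * ((1 - 2 * (47 / 100 : ℝ)) * (2 * (δL - 3 * r)) * (κ ^ 2 / (4 * b ^ 2)) * Φ ^ 2) := by
  have hT0 : 0 < T := by nlinarith [Real.exp_pos (2 * b)]
  have hb00 : 0 < b := by linarith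
  have hC := cost_le_slabSix hb0 hb1 he hTe hTT₀ hk2 hk hcI hcI3 hcL hxL hδ0 hδ1
  have hG := gain_ge_slabSix hb0 hL1 hQ0 hQ hκ₀ hκ hr hy hδL hpU0 hpU hT0 hTT₀ hΦ₀ hΦ
  refine lt_of_le_of_lt hC (lt_of_lt_of_le ?_ hG)
  have hE := Real.exp_pos (2 * b)
  have hE4 : Real.exp (4 * b) = Real.exp (2 * b) * Real.exp (2 * b) := by rw [← Real.exp_add]; ring_nf
  rw [hE4, div_lt_div_iff₀ hE (by positivity)]
  -- `2.74(b+0.834)·(b·E·E) < 0.0256κ₀²Φ₀²·E` from `b(b+0.834)E ≤ B₂(B₂+0.834)X`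
  have h1 : b * (b + 0.834) * Real.exp (2 * b) ≤ B₂ * (B₂ + 0.834) * X := by
    have hbb : b * (b + 0.834) ≤ B₂ * (B₂ + 0.834) := by nlinarith
    exact mul_le_mul hbb hX hE.le (by nlinarith)
  nlinarith [h1, hval, hE]

end Summit.RiemannHypothesis.RiemannHypothesis.Theorems.Handoff

end
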